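import Literature.MathematicalPhysics.QuantumFieldTheory.Balaban1983to89.B14Eq357ExtensionZd
import Literature.MathematicalPhysics.QuantumFieldTheory.Balaban1983to89.TreeLengthTorusTransfer

/-!
# `Balaban1983to89.B14.Eq348TorusClasses` — [Balaban1988Convergent] pp. 279–281: the two classes (I.3.5)
# «X ⊂ □^{∼2}, X∩(□^{∼2})ᶜ ≠ ∅» above the cube of `z` ON BAŁABAN'S PERIODIC CARRIER (the torus cube system
# `TreeLengthTorus.tcubeSys`), the (3.48) geometry `d_j(X) ≥ 2(LʲL⁻ⁿ)⁻¹` of the second class for the torus linear size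
# `torusTreeLen` (the hypothesis `hclass` of `B14.Eq348SecondClass` / `B14.Eq356ExtensionFeed` DISCHARGED on the torus),
# and the p. 281 passage «to all domains X ∈ 𝐃_j for the space L⁻ʲZ^d» for the torus: its first class above `□_z` IS the
# first class of the universal cover above a lift of `□_z` (unique lifting inside `□^{∼2}`) — the identification that
# `B14.Eq357ExtensionZd` §5 took as a hypothesis, CONSTRUCTED

HONEST FRAMING (cell `lit-balaban`, verbatim): statement-level skeleton of published theorems with citation tags;
proofs where landed; nothing here is a claim about the Yang–Mills mass gap.

CITATION HEADER (lean-in-tree rule).  Source: T. Bałaban, *Convergent renormalization expansions for lattice gauge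
theories*, Commun. Math. Phys. **119** (1988) 243–285, doi:10.1007/bf01217741 [Balaban1988Convergent] (cell paper
B14 = "[III]"; PDF held `paper:balaban1988-cmp119-convergent-renormalization`, journal page = PDF page + 242; text layer
p0037–p0039 re-read by the author of this file, 2026-08-22): p. 279 [PDF 37] l.46–47 the two cases (I.3.5), (3.48) p. 280
[PDF 38] l.2–6, the resummation paragraph (3.56)→(3.57) p. 281 [PDF 39] l.21–30, (2.27)(i)–(iv) p. 259 [PDF 17], p. 245
[PDF 3] l.28 («the lattice T_η»); [I] = T. Bałaban, Commun. Math. Phys. **109** (1987) 249–301 [Balaban1987RG1]: p. 251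
(the torus), p. 257 (π_j, the localization domains 𝐃_j, d_j), (1.18) p. 263, (3.5) p. 271, (4.16)–(4.17) p. 285; [II] =
T. Bałaban, Commun. Math. Phys. **116** (1988) 1–22 [Balaban1988RG2Cluster], (1.26) p. 8.  Mega-formalization
`lit-balaban` (HOME `run/shared/lean/pub/lit-balaban/`), reader/typer unit `lit-balaban-r11` (generation 13, fold owner of
B14), SKELETON rows **B14.Eq3.48** (cell: (3.48) on the torus carrier), **B14.Eq3.55–3.57** (cell: the (3.56)→(3.57)
extension for the torus), **B14.Thm2** (status cell, honest-frontier item (ii) of `lit-balaban-r11/B14-CLOSURE.md` §3.2: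
«the identification of the torus's first class above □_z with the first class above the cube x on L⁻ʲZ^d … remains a
hypothesis FOR THE TORUS»).  Imports the row's own `…B14Eq357ExtensionZd` (gen 12: the two classes `SecondAbove`/
`FirstAbove` of the infinite lattice, the second-class series, the extension identity, `extensionDiff_secondAbove_le`, and
§5 `sum_torusFirst_eq_of_equiv`/`abs_sum_torusFirst_sub_tsum_le` UNDER an identification `Equiv`) and the cell's
`…TreeLengthTorusTransfer` (unit pv22/joiner lineage: `coarse_add_period`; through it `…TreeLengthTorusGeometry`:
`period`, `proj_add_period`, `exists_period_of_proj_eq`, and `…TreeLengthTorus`: `TPt`, `proj`, `TAdj`, `TFaceConnected`,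
`TAdmissible`, `torusTreeLen`, `exists_tAdmissible`, `le_torusTreeLen`, `exists_lift_adj`, `tFaceConnected_image`, `tsys`,
`tcubeSys`, `tdegreeLE`, `tvolumeLeaf`); uses `…B14.Eq348ClassGeometry` (`InEnl`, `not_inEnl_iff`, `blockGap_le_abs_sub`,
`abs_sub_le_len_add_one`), `…B14.Eq348SecondClass` (the abstract (3.48) sums), `…B14.Eq356ExtensionFeed`
(`extensionDiff_secondClass_le`) BY NAME; modifies nothing.  New vocabulary: two predicates (`TInEnl`, `TSecondAbove`) and
one finite set (`tlift`) with bodies; NO new `Prop`-valued named fact (D-0026).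

THE PRINTED TEXT (verbatim).  p. 279 [PDF 37] – p. 280 [PDF 38]: *«Consider the two cases (I.3.5): X ⊂ □^{∼2},
X∩(□^{∼2})ᶜ ≠ ∅ (the ∼-operation is in the L⁻ⁿ-scale). In the second case the function 𝐄^{(j)}(X, z) is already very
small by the bound (I.1.18): |𝐄^{(j)}(X, z)| ≦ E₀ exp(−κ(LʲL⁻ⁿ)⁻¹) exp(−½κd_j(X)). (3.48)  In the proof of Theorem 2 we
simply estimate all these terms using the above bound, and the sum over X is bounded by O(1)exp(−κ(LʲL⁻ⁿ)⁻¹) ≦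
O(1)(LʲL⁻ⁿ)⁵. This is an admissible error contributing only to the constant on the right-hand side of (2.43).»*;
p. 281 [PDF 39]: *«The identities (3.56) hold for the localization domains X satisfying the condition X ⊂ □̃^{∼2}. We
sum up the identities over all such domains, and we extend the sum on the right-hand side to all domains X ∈ 𝐃_j for the
space L⁻ʲZ^d, X containing the point z. The difference between the two sums contributes to the irrelevant terms only, by
the bounds (3.48).»*  The carrier: p. 245 *«two additional partitions of the lattice T_η into large cubes»*, T_η the
lattice torus of [I] p. 251 *«a torus T obtained by the usual identification of boundary points of the cube
{x ∈ R^d : −L_μ ≦ x_μ ≦ L_μ, μ = 1, …, d}»*; [I] p. 257 *«We decompose the space T into the lattice of closed cubes … We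
denote this family of cubes by π_j»*.

THE MODEL (that of `…TreeLengthTorus` / `…B14.Eq348ClassGeometry`, lattice units).  The cubes of π_j of the torus with
`P` cubes per direction are indexed by `TPt d P = (ℤ/P)^d`, those of its universal cover by `Pt d = ℤ^d`, with covering
projection `proj P`; the torus localization domains 𝐃_j are the non-empty torus-face-connected families (`tsys d P`,
`d_j := torusTreeLen`, computed in the cover), organised as the cube system `tcubeSys d P` of `B12TreeDecay`; the
π_n-block of a cube `y` of the cover is `coarse Nb y = ⌊y/Nb⌋`, `Nb = Lⁿ⁻ʲ`, and «`y ∈ □^{∼r}(x)`» in the cover is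
`InEnl Nb r x y` (block indices within `r` in every coordinate).  (T1) «`b̄ ∈ □^{∼r}(ā)`» ON THE TORUS is read as: the
cube `b̄` lies in the covering image of a window `□^{∼r}(x)` above a lift `x` of `ā` (`TInEnl`) — when the π_n-cubes tile
the torus (`P = Nb·Pb`, Bałaban's situation: π_n is a partition of the same torus) this is independent of the lift
(`tInEnl_iff_exists_lift`) and is membership in the enlarged π_n-cube `□^{∼r}` of the torus with its wrap-around block
distance.  (T2) «X ∋ z»: the cube `c̄z` of `z` is a cube of `X̄` (`(tcubeSys d P).above c̄z`), as in the window and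
infinite-lattice files.

WHAT THIS FILE PROVES (kernel-checked; no `sorry`).
* §1 `TInEnl Nb r ā b̄` / `TSecondAbove Nb c̄z X̄` («X∩(□^{∼2})ᶜ ≠ ∅» above `c̄z`), `not_tSecondAbove_iff` (its complement
  is «X ⊂ □^{∼2}»), reflexivity/symmetry, `not_tInEnl_iff`.
* §2 **(3.48)'s geometry ON THE TORUS, no width hypothesis**: `mul_le_torusTreeLen_of_not_tInEnl` (a cube of `X̄` outside
  `□^{∼r}` of another forces `torusTreeLen X̄ ≥ r·Nb`: an admissible graph of the cover meets lifts which are not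
  block-close), `two_mul_le_torusTreeLen_of_not_tInEnl`, **`thclass_tcubeSys`** — the hypothesis `hclass` («second class ⇒
  d_j(X) ≥ 2(LʲL⁻ⁿ)⁻¹») of `B14.Eq348SecondClass.secondClass_sum_le` and of `B14.Eq356ExtensionFeed.extensionDiff_
  secondClass_le` DISCHARGED for `tcubeSys d P`; hence, with `tdegreeLE`/`tvolumeLeaf` ([II] (1.26) on the torus), the
  torus versions with ONLY (I.1.18) as hypothesis of *"the sum over X is bounded by O(1)exp(−κ(LʲL⁻ⁿ)⁻¹) ≦ O(1)(LʲL⁻ⁿ)⁵"*: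
  `secondAbove_sum_le_torus` (`≤ E₀K₀(4·2^d,2d)e^{−κNb}`), `…_pow_five_torus`, `abs_secondAbove_sum_le_torus`
  (`≤ E₀K₀(5/κ)⁵e⁻⁵(Nb⁻¹)^{5−b}`), `secondAbove_sum_le_scales_torus` (`Nb = Lⁿ⁻ʲ`, shape `c·(L^{j−n})^{5−b}` of
  `B14Sect3.Rep367`), and AT CHART LEVEL **`extensionDiff_secondAbove_torus_le`** (`…Eq356ExtensionFeed.extensionDiff_
  secondClass_le` on the torus with `hclass` supplied: `|Σ_{torus second class} m| ≤ (C·E₀·K₀·(5/κ)⁵e⁻⁵)(L^{j−n})^{5−β}`).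
* §3 **THE IDENTIFICATION CONSTRUCTED** for a torus of `Nb·Pb` cubes of π_j per direction: lift-independence
  (`exists_lift_inEnl_of_tInEnl`, `tInEnl_iff_exists_lift`), uniqueness of lifts inside the window for `Pb ≥ 5`
  (`eq_of_inEnl_of_proj_eq`), lifting of common walls inside the window for `Pb ≥ 6` (`adj_of_lifts`), the lift
  `tlift Nb x X̄` of a torus family through the window above `x` with `image_proj_tlift` (it projects onto `X̄`) and
  `faceConnected_tlift`; **`exists_firstClassEquiv_torus`**: for `Pb ≥ 6` the torus first class above `c̄z` («X̄ ∋ □_z,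
  X̄ ⊂ □^{∼2}») is in bijection with the first class `FirstAbove Nb x` of `L⁻ʲZ^d` above any lift `x` of `c̄z`, by lifting —
  the `Equiv` of `…Eq357ExtensionZd` §5; hence **`sum_torusFirst_eq`** / **`abs_sum_torusFirst_sub_tsum_le`** (the §5
  identity and bound for the torus with the identification no longer a hypothesis: the torus first-class sum = the
  whole-lattice series over «X containing the point z» − the second-class series of `L⁻ʲZ^d`) and
  **`extension357_torus_of_charts`** (the p. 281 sentence for the torus carrier under the chart hypotheses of
  `…Eq357ExtensionZd.extensionDiff_secondAbove_le` and the term identification (T3) below).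
* §4 both classes at once: `sum_above_eq_first_add_second`, `abs_sum_torusAbove_sub_tsum_le` and
  **`extension357_torusAbove_of_charts`** — the sum of the torus main terms over ALL `X̄ ∈ 𝐃_j` above `□_z` differs from the
  (3.57) whole-lattice coefficient `Σ'_{Y ∋ x} mZ(Y)` by at most `2·(C·E₀·K₀(4·2^d,2d)·(5/κ)⁵e⁻⁵)·(L^{j−n})^{5−β}`
  ((3.48) on the torus + the extension difference on `L⁻ʲZ^d`).

HONEST SCOPE.  (T3) What remains a hypothesis is the identification of the TERMS, not of the domains: `hterm` — the torus
term of a first-class domain `X̄ ⊂ □̃^{∼2}` equals the whole-lattice term of its lift — is (2.27)(i) *"it depends on U_k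
restricted to X"* together with Bałaban's inductive construction of the same local functionals `𝐄^{(j)}(X, ·)` on every
lattice ([III] p. 281: *"𝐄^{(j)}(U_j, z) defined on the whole lattice L⁻ʲZ^d"*); it is a property of Bałaban's functions
(Theorem 1's territory, the one-carrier instantiation of `B14-CLOSURE.md` §3.2 (iii)), stated here about two families of
reals.  (1) The width hypothesis `Pb ≥ 6` (at least six π_n-cubes per direction, so that the five-block window `□^{∼2}`
and its wall-neighbours do not wrap) is the located form of the reading «a torus wider than 5N cubes does not let □̃^{∼2}
wrap» of `…Eq357ExtensionZd`'s HONEST SCOPE (1); for `Pb = 5` a domain winding around the torus lies in `□^{∼2}` and has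
no lift, so the hypothesis is sharp for the bijection; print's tori T_η are macroscopic (p. 245, [I] p. 251) and the
hypothesis is not printed.  (2) §2 needs neither `Nb ∣ P` nor any width: with the lift reading (T1) a far cube is far
for every pair of lifts.  (3) `E₀, κ` are the constants of (2.27)(iv) = (I.1.18) ([I] (1.18) p. 263 carries `g_{j−1}`);
the (1.26) threshold/constant are `κ₀(4·2^d, 2d)`, `K₀(4·2^d, 2d)` of `B12TreeDecay`, on the torus via `tvolumeLeaf` and
on `L⁻ʲZ^d` via the window theorem, as in the imported files.  (4) As in `…Eq356ExtensionFeed`/`…Eq357ExtensionZd` the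
extension is performed on the (3.49)-form `½⟨𝐄^{(2)}, w, w⟩` of the main term (print performs it at the (3.56) stage —
same bilinear power counting); nothing about (3.66)'s relocation estimates, nothing about the Yang–Mills mass gap.
(5) Row-head policy G.5-45 unchanged: B14.Thm2 keeps its head; this file closes honest-frontier item §3.2 (ii) of
`B14-CLOSURE.md` at the combinatorial level for Bałaban's own carrier.

## References
* [Balaban1988Convergent] T. Bałaban, Commun. Math. Phys. 119 (1988) 243–285: p.279 (the two cases (I.3.5)), (3.48)
  p.280, (3.56)–(3.57) p.281, (2.27) p.259, p.245 (the lattice T_η).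
* [Balaban1987RG1] T. Bałaban, Commun. Math. Phys. 109 (1987) 249–301 ([I]: p.251 (torus), p.257 (π_j, 𝐃_j, d_j), (1.18)
  p.263, (3.5) p.271, (4.16)–(4.17) p.285).
* [Balaban1988RG2Cluster] T. Bałaban, Commun. Math. Phys. 116 (1988) 1–22 ([II]: (1.26) p.8).
-/

open scoped Topology BigOperators

namespace Literature.MathematicalPhysics.QuantumFieldTheory.Balaban1983to89.B14.Eq348TorusClasses

noncomputable section

open Literature.MathematicalPhysics.QuantumFieldTheory.Balaban1983to89
open Literature.MathematicalPhysics.QuantumFieldTheory.Balaban1983to89.B13ScaleTransfer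
open Literature.MathematicalPhysics.QuantumFieldTheory.Balaban1983to89.TreeLength
open Literature.MathematicalPhysics.QuantumFieldTheory.Balaban1983to89.B12TreeDecay
open Literature.MathematicalPhysics.QuantumFieldTheory.Balaban1983to89.TreeLengthTorus
open Literature.MathematicalPhysics.QuantumFieldTheory.Balaban1983to89.TreeLengthTorusGeometry
open Literature.MathematicalPhysics.QuantumFieldTheory.Balaban1983to89.TreeLengthTorusTransfer
open Literature.MathematicalPhysics.QuantumFieldTheory.Balaban1983to89.B14.Eq348ClassGeometry
open Literature.MathematicalPhysics.QuantumFieldTheory.Balaban1983to89.B14.Eq357KernelDecay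
open Literature.MathematicalPhysics.QuantumFieldTheory.Balaban1983to89.B14.Eq357ExtensionZd
open Finset

variable {d : ℕ} {P : ℕ}

/-! ## §1. «□^{∼2}» on the torus (the covering image of the window of the universal cover) and the two classes -/

/-- Membership in `□^{∼r}(x)` on `ℤ^d` is symmetric in the two cubes (block indices within `r` of each other).
[folklore] -/
private theorem inEnl_comm {N r : ℕ} {x y : Pt d} : InEnl N r x y ↔ InEnl N r y x := by
  unfold InEnl
  exact forall_congr' fun i => by rw [abs_sub_comm]

/-- **`b̄ ∈ □^{∼r}(ā)` ON THE TORUS** ([Balaban1988Convergent] p. 279: *"Consider the two cases (I.3.5): X ⊂ □^{∼2},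
X∩(□^{∼2})ᶜ ≠ ∅ (the ∼-operation is in the L⁻ⁿ-scale)"*, for the localization domains of the lattice T_η of p. 245, the
torus of [Balaban1987RG1] p. 251 *"obtained by the usual identification of boundary points of the cube"*): the cube `b̄`
of the torus π_j lies in the covering image of an enlarged block window `□^{∼r}(x)` of the universal cover `ℤ^d`
(`…Eq348ClassGeometry.InEnl`, blocks of `Nb = Lⁿ⁻ʲ` cubes) above some lift `x` of `ā` — i.e. SOME lifts `x` of `ā` and `y`
of `b̄` have π_n-block indices within `r` in every coordinate.  When the π_n-blocks tile the torus (`Nb ∣ P`) this does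
not depend on the lift of `ā` (`tInEnl_iff_exists_lift`) and is the printed «b̄'s cube ⊂ □^{∼r}», `□` the π_n-cube of
`ā`, with the torus (wrap-around) block distance. [cite: Balaban1988Convergent, p.279 (the two cases (I.3.5));
Balaban1987RG1, p.251 (torus), (3.5) p.271] -/
def TInEnl (Nb r : ℕ) (a b : TPt d P) : Prop :=
  ∃ x y : Pt d, proj P x = a ∧ proj P y = b ∧ InEnl Nb r x y

/-- Block-close cubes of the cover project to `∼r`-close cubes of the torus (the covering image of the window; reading
(T1) of the module docstring). [cite: Balaban1988Convergent, p.279 (the two cases (I.3.5)); Balaban1987RG1, p.251 (torus)] -/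
theorem tInEnl_of_inEnl {Nb r : ℕ} {x y : Pt d} (h : InEnl Nb r x y) : TInEnl Nb r (proj P x) (proj P y) :=
  ⟨x, y, rfl, rfl, h⟩

/-- `ā ∈ □^{∼r}(ā)` on the torus. [cite: Balaban1988Convergent, p.279 (the two cases (I.3.5))] -/
theorem tInEnl_refl [NeZero P] (Nb r : ℕ) (a : TPt d P) : TInEnl Nb r a a :=
  ⟨natLift a, natLift a, proj_natLift a, proj_natLift a, inEnl_refl Nb r _⟩

/-- `□^{∼r}`-closeness on the torus is symmetric in the two cubes (derived here, not printed).
[cite: Balaban1988Convergent, p.279 (the two cases (I.3.5))] -/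
theorem tInEnl_comm {Nb r : ℕ} {a b : TPt d P} : TInEnl Nb r a b ↔ TInEnl Nb r b a := by
  constructor
  · rintro ⟨x, y, hx, hy, h⟩
    exact ⟨y, x, hy, hx, inEnl_comm.1 h⟩
  · rintro ⟨x, y, hx, hy, h⟩
    exact ⟨y, x, hy, hx, inEnl_comm.1 h⟩

/-- `b̄ ∉ □^{∼r}(ā)` on the torus — *"X∩(□^{∼2})ᶜ ≠ ∅"* cube by cube — iff NO lifts of `ā`, `b̄` are block-close in the
cover. [cite: Balaban1988Convergent, p.279 (the two cases (I.3.5))] -/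
theorem not_tInEnl_iff {Nb r : ℕ} {a b : TPt d P} :
    ¬ TInEnl Nb r a b ↔ ∀ x y : Pt d, proj P x = a → proj P y = b → ¬ InEnl Nb r x y := by
  simp only [TInEnl, not_exists, not_and]

/-- **THE SECOND CLASS ABOVE `□_z` ON THE TORUS** (pp. 279–280): the torus localization domains `X̄ ∈ 𝐃_j`
(`TreeLengthTorus.tsys`) having `c̄z` (the cube of `z`) among their cubes and some cube outside `□^{∼2}(c̄z)` —
*"X∩(□^{∼2})ᶜ ≠ ∅ (the ∼-operation is in the L⁻ⁿ-scale)"*; the torus twin of `…Eq348ClassGeometry.SecondClass`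
(window carrier) and of `…Eq357ExtensionZd.SecondAbove` (infinite lattice).  («X ∋ z» — `c̄z ∈ X̄` — is carried by the
finite set `(tcubeSys d P).above c̄z` this predicate is filtered on.) [cite: Balaban1988Convergent, p.279 (the two cases
(I.3.5)), (3.48) p.280] -/
def TSecondAbove [NeZero P] (Nb : ℕ) (cz : TPt d P) (X : (tsys d P).Dom) : Prop := ∃ b ∈ X.1, ¬ TInEnl Nb 2 cz b

/-- Membership in the torus second class is decided classically (the lifts range over `ℤ^d`). [folklore] -/
instance instDecidablePredTSecondAbove [NeZero P] (Nb : ℕ) (cz : TPt d P) :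
    DecidablePred (TSecondAbove Nb cz) := Classical.decPred _

/-- Its complement is the first class *"X ⊂ □^{∼2}"*: every cube of `X̄` lies in `□^{∼2}(c̄z)`.
[cite: Balaban1988Convergent, p.279 (the two cases (I.3.5))] -/
theorem not_tSecondAbove_iff [NeZero P] {Nb : ℕ} {cz : TPt d P} {X : (tsys d P).Dom} :
    ¬ TSecondAbove Nb cz X ↔ ∀ b ∈ X.1, TInEnl Nb 2 cz b := by
  simp [TSecondAbove]

/-! ## §2. (3.48) on the torus: `d_j(X̄) ≥ 2(LʲL⁻ⁿ)⁻¹` on the second class — `hclass` for `torusTreeLen` PROVED -/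

/-- **`d_j(X̄) ≥ r·Nb` from a torus cube outside `□^{∼r}`** (the lattice arithmetic of [I] (3.5) on the periodic carrier):
if the torus localization domain `X̄` has cubes `ā`, `b̄` with `b̄ ∉ □^{∼r}(ā)`, then every graph admissible for `X̄`
(`TreeLengthTorus.TAdmissible`: a connected graph of the universal cover inside `π⁻¹(X̄)` meeting a lift of every cube of
`X̄`) meets lifts `x`, `y` of `ā`, `b̄`, which are NOT block-close, so `|y_μ − x_μ| ≥ rNb + 1` in some coordinate
(`…Eq348ClassGeometry.blockGap_le_abs_sub`) and the graph is at least `rNb` long (`…abs_sub_le_len_add_one`); hence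
`torusTreeLen X̄ ≥ r·Nb`.  No hypothesis on the torus width. [cite: Balaban1987RG1, (3.5) p.271, p.257 (linear size d_j);
Balaban1988Convergent, (3.48) p.280] -/
theorem mul_le_torusTreeLen_of_not_tInEnl [NeZero P] {X : Finset (TPt d P)} (hX : X.Nonempty)
    (hc : TFaceConnected X) {Nb r : ℕ} (hNb : 0 < Nb) {a b : TPt d P} (ha : a ∈ X) (hb : b ∈ X)
    (h : ¬ TInEnl Nb r a b) : (r : ℝ) * Nb ≤ torusTreeLen X := by
  classical
  refine le_torusTreeLen ((exists_tAdmissible hX hc).imp fun T hT => hT.1) fun T hT => ?_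
  obtain ⟨x, hxa, hxm⟩ := hT.meets a ha
  obtain ⟨y, hyb, hym⟩ := hT.meets b hb
  have hfar : ¬ InEnl Nb r x y := not_tInEnl_iff.1 h x y hxa hyb
  obtain ⟨i, hi⟩ := not_inEnl_iff.1 hfar
  have hgap := blockGap_le_abs_sub hNb hi
  have hS : SAdmissible ({x, y} : Finset (Pt d)) T := by
    refine ⟨hT.connected, fun z hz => ?_⟩
    rcases Finset.mem_insert.1 hz with rfl | hz
    · exact hxm
    · rw [Finset.mem_singleton] at hz
      subst hz
      exact hym
  have h1 := abs_sub_le_len_add_one hS (Finset.mem_insert_self x {y})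
    (Finset.mem_insert_of_mem (Finset.mem_singleton_self y)) i
  have hgap' : (r : ℝ) * Nb + 1 ≤ |((y i : ℝ)) - x i| := by
    have h3 := (Int.cast_le (R := ℝ)).2 hgap
    push_cast at h3
    exact h3
  rw [abs_sub_comm] at h1
  linarith

/-- **(3.48)'s geometry ON THE TORUS**: a torus localization domain containing the cube `c̄z` and a cube outside
`□^{∼2}(c̄z)` has `d_j(X̄) ≥ 2Nb = 2(LʲL⁻ⁿ)⁻¹` (`torusTreeLen`) — the exponent bookkeeping turning (I.1.18) into (3.48)
`E₀exp(−κ(LʲL⁻ⁿ)⁻¹)exp(−½κd_j(X))` on Bałaban's own carrier. [cite: Balaban1988Convergent, (3.48) p.280] -/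
theorem two_mul_le_torusTreeLen_of_not_tInEnl [NeZero P] {X : Finset (TPt d P)} (hX : X.Nonempty)
    (hc : TFaceConnected X) {Nb : ℕ} (hNb : 0 < Nb) {a b : TPt d P} (ha : a ∈ X) (hb : b ∈ X)
    (h : ¬ TInEnl Nb 2 a b) : 2 * (Nb : ℝ) ≤ torusTreeLen X := by
  have h' := mul_le_torusTreeLen_of_not_tInEnl hX hc hNb ha hb h
  exact_mod_cast h'

/-- **`hclass` PROVED ON THE TORUS**: on `tcubeSys d P` (d_j = `torusTreeLen`), every second-class domain above the cube
`c̄z` has `d_j(X̄) ≥ 2Nb` — literally the hypothesis `hclass` of `B14.Eq348SecondClass.secondClass_sum_le` / of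
`B14.Eq356ExtensionFeed.extensionDiff_secondClass_le` with `D = Nb`, for the periodic carrier; no width hypothesis.
[cite: Balaban1988Convergent, (3.48) p.280] -/
theorem thclass_tcubeSys (d P : ℕ) [NeZero P] {Nb : ℕ} (hNb : 0 < Nb) (cz : TPt d P) :
    ∀ X ∈ (tcubeSys d P).above cz, TSecondAbove Nb cz X → 2 * (Nb : ℝ) ≤ (tsys d P).dj X := by
  intro X hX hsec
  obtain ⟨b, hb, hnb⟩ := hsec
  have hcz : cz ∈ X.1 := (CubeSystem.mem_above (tcubeSys d P)).1 hX
  rw [tsys_dj]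
  exact two_mul_le_torusTreeLen_of_not_tInEnl X.2.1 X.2.2 hNb hcz hb hnb

/-- The same in the `s⁻¹`-form (`s = LʲL⁻ⁿ = Nb⁻¹`) of `B14.Eq348SecondClass.secondClass_sum_le_pow_five`.
[cite: Balaban1988Convergent, (3.48) p.280] -/
theorem thclass_tcubeSys_inv (d P : ℕ) [NeZero P] {Nb : ℕ} (hNb : 0 < Nb) (cz : TPt d P) :
    ∀ X ∈ (tcubeSys d P).above cz, TSecondAbove Nb cz X → 2 * ((Nb : ℝ)⁻¹)⁻¹ ≤ (tsys d P).dj X := by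
  rw [inv_inv]
  exact thclass_tcubeSys d P hNb cz

/-- **p. 280, *"the sum over X is bounded by O(1)exp(−κ(LʲL⁻ⁿ)⁻¹)"* ON THE TORUS, WITH ONLY (I.1.18) AS HYPOTHESIS**: for
every cube `c̄z` of the torus π_j (`P ≥ 1` cubes per direction), every block size `Nb ≥ 1` and reals `𝐄^{(j)}(X̄, z)`
obeying (I.1.18) `|𝐄^{(j)}(X̄, z)| ≤ E₀e^{−κd_j(X̄)}` with `κ/2 ≥ κ₀(4·2^d, 2d)`:
`Σ_{X̄ ∋ c̄z, X̄ ⊄ □^{∼2}} |𝐄^{(j)}(X̄, z)| ≤ E₀·K₀(4·2^d, 2d)·e^{−κNb}` — `B14.Eq348SecondClass.secondClass_sum_le` with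
`tdegreeLE`, `tvolumeLeaf` ([II] (1.26) on the torus) and `thclass_tcubeSys`. [cite: Balaban1988Convergent, (3.48) p.280;
Balaban1988RG2Cluster, (1.26) p.8] -/
theorem secondAbove_sum_le_torus (d P : ℕ) [NeZero P] {Nb : ℕ} (hNb : 0 < Nb) (cz : TPt d P)
    {E : (tsys d P).Dom → ℝ} {E₀ κ : ℝ} (hE₀ : 0 ≤ E₀) (hκ : kappa₀ (4 * 2 ^ d) (2 * d) ≤ κ / 2) (hκ0 : 0 ≤ κ)
    (h118 : ∀ X, |E X| ≤ E₀ * Real.exp (-κ * (tsys d P).dj X)) :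
    ∑ X ∈ ((tcubeSys d P).above cz).filter (TSecondAbove Nb cz), |E X|
      ≤ E₀ * K₀ (4 * 2 ^ d) (2 * d) * Real.exp (-(κ * Nb)) :=
  Eq348SecondClass.secondClass_sum_le (tcubeSys d P) (tdegreeLE d P) (tvolumeLeaf d P) hE₀ hκ hκ0 h118 cz
    (TSecondAbove Nb cz) (thclass_tcubeSys d P hNb cz)

/-- **p. 280, *"≦ O(1)(LʲL⁻ⁿ)⁵"* ON THE TORUS, WITH ONLY (I.1.18) AS HYPOTHESIS**: the same sum is
`≤ E₀K₀(4·2^d, 2d)(5/κ)⁵e⁻⁵·(Nb⁻¹)⁵` (`κ > 0`; `Nb⁻¹ = LʲL⁻ⁿ`). [cite: Balaban1988Convergent, (3.48) p.280] -/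
theorem secondAbove_sum_le_pow_five_torus (d P : ℕ) [NeZero P] {Nb : ℕ} (hNb : 0 < Nb) (cz : TPt d P)
    {E : (tsys d P).Dom → ℝ} {E₀ κ : ℝ} (hE₀ : 0 ≤ E₀) (hκ : kappa₀ (4 * 2 ^ d) (2 * d) ≤ κ / 2) (hκ0 : 0 < κ)
    (h118 : ∀ X, |E X| ≤ E₀ * Real.exp (-κ * (tsys d P).dj X)) :
    ∑ X ∈ ((tcubeSys d P).above cz).filter (TSecondAbove Nb cz), |E X|
      ≤ E₀ * K₀ (4 * 2 ^ d) (2 * d) * (((5 : ℝ) / κ) ^ 5 * Real.exp (-(5 : ℝ))) * ((Nb : ℝ)⁻¹) ^ 5 :=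
  Eq348SecondClass.secondClass_sum_le_pow_five (tcubeSys d P) (tdegreeLE d P) (tvolumeLeaf d P) hE₀ hκ hκ0
    (inv_pos.2 (by exact_mod_cast hNb)) h118 cz (TSecondAbove Nb cz) (thclass_tcubeSys_inv d P hNb cz)

/-- **"an admissible error contributing only to the constant on the right-hand side of (2.43)"** (p. 280) ON THE TORUS,
signed form, (I.1.18) the only hypothesis: `|Σ_{X̄ ∋ c̄z, X̄ ⊄ □^{∼2}} 𝐄^{(j)}(X̄, z)| ≤ E₀K₀(4·2^d, 2d)(5/κ)⁵e⁻⁵·(Nb⁻¹)^{5−b}`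
for every `b ≥ 0`. [cite: Balaban1988Convergent, (3.48) p.280] -/
theorem abs_secondAbove_sum_le_torus (d P : ℕ) [NeZero P] {Nb : ℕ} (hNb : 0 < Nb) (cz : TPt d P)
    {E : (tsys d P).Dom → ℝ} {E₀ κ b : ℝ} (hE₀ : 0 ≤ E₀) (hκ : kappa₀ (4 * 2 ^ d) (2 * d) ≤ κ / 2) (hκ0 : 0 < κ)
    (hb : 0 ≤ b) (h118 : ∀ X, |E X| ≤ E₀ * Real.exp (-κ * (tsys d P).dj X)) :
    |∑ X ∈ ((tcubeSys d P).above cz).filter (TSecondAbove Nb cz), E X|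
      ≤ E₀ * K₀ (4 * 2 ^ d) (2 * d) * (((5 : ℝ) / κ) ^ 5 * Real.exp (-(5 : ℝ))) * ((Nb : ℝ)⁻¹) ^ ((5 : ℝ) - b) := by
  have hN1 : (1 : ℝ) ≤ Nb := by exact_mod_cast hNb
  exact Eq348SecondClass.abs_secondClass_sum_le (tcubeSys d P) (tdegreeLE d P) (tvolumeLeaf d P) hE₀ hκ hκ0
    (inv_pos.2 (by linarith)) (inv_le_one_of_one_le₀ hN1) hb h118 cz (TSecondAbove Nb cz)
    (thclass_tcubeSys_inv d P hNb cz)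

/-- `LʲL⁻ⁿ` as printed: for `j ≤ n` and `L > 0`, the real power `L^{(j−n)}` is `(Lⁿ⁻ʲ)⁻¹ = Nb⁻¹`. [folklore] -/
private theorem rpow_sub_eq_inv_pow {L : ℝ} (hL : 0 < L) {j n : ℕ} (hjn : j ≤ n) :
    L ^ ((j : ℝ) - n) = ((L ^ (n - j) : ℝ))⁻¹ := by
  rw [Real.rpow_sub hL, Real.rpow_natCast, Real.rpow_natCast]
  rw [← pow_sub_mul_pow L hjn]
  field_simp

/-- **The printed scales ON THE TORUS**: with `Nb = Lⁿ⁻ʲ` (`j ≤ n`, `L ≥ 1` an integer) the signed second-class sum above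
the cube of `z` is `≤ E₀K₀(4·2^d, 2d)(5/κ)⁵e⁻⁵·(L^{j−n})^{5−b}` — the per-point shape `c·(L^{(j−n)})^{5−b}` of
`B14Sect3.Rep367` / `B14.Eq367Assembly`, (I.1.18) the only hypothesis. [cite: Balaban1988Convergent, (3.48) p.280] -/
theorem secondAbove_sum_le_scales_torus (d P : ℕ) [NeZero P] {L : ℕ} (hL : 0 < L) {j n : ℕ} (hjn : j ≤ n)
    (cz : TPt d P) {E : (tsys d P).Dom → ℝ} {E₀ κ b : ℝ} (hE₀ : 0 ≤ E₀)
    (hκ : kappa₀ (4 * 2 ^ d) (2 * d) ≤ κ / 2) (hκ0 : 0 < κ) (hb : 0 ≤ b)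
    (h118 : ∀ X, |E X| ≤ E₀ * Real.exp (-κ * (tsys d P).dj X)) :
    |∑ X ∈ ((tcubeSys d P).above cz).filter (TSecondAbove (L ^ (n - j)) cz), E X|
      ≤ E₀ * K₀ (4 * 2 ^ d) (2 * d) * (((5 : ℝ) / κ) ^ 5 * Real.exp (-(5 : ℝ)))
        * ((L : ℝ) ^ ((j : ℝ) - n)) ^ ((5 : ℝ) - b) := by
  have hN : 0 < L ^ (n - j) := pow_pos hL _
  have h := abs_secondAbove_sum_le_torus d P hN cz hE₀ hκ hκ0 hb h118
  have hL' : (0 : ℝ) < L := by exact_mod_cast hL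
  rw [rpow_sub_eq_inv_pow hL' hjn]
  push_cast at h ⊢
  exact h

section Chart

variable {𝔄 : Type*} [NormedRing 𝔄] [NormedAlgebra ℝ 𝔄] {Λ T : Type*} [Fintype Λ] [Fintype T]
  {V : Type*} [NormedAddCommGroup V] [NormedSpace ℂ V] {F : Type*} [NormedAddCommGroup F]
  [NormedSpace ℂ F] [CompleteSpace F]

open NormedSpace (exp)

-- (the nested operator space over the iterated `Pi` type: one more level of pending instance synthesis)
set_option maxSynthPendingDepth 3 in
/-- **p. 281, the torus's own second-class part of the extension difference at the point `z`, `hclass`-FREE**: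
`B14.Eq356ExtensionFeed.extensionDiff_secondClass_le` ON THE TORUS CUBE SYSTEM `tcubeSys d P` with its degree bound
`tdegreeLE`, volume leaf `tvolumeLeaf` and the class geometry `thclass_tcubeSys` SUPPLIED: ONE cube `c̄z` (of `z`, scale
`n ≥ j`, `Nb = Lⁿ⁻ʲ`, `L ≥ 1` an integer), ONE functional `ℰ_X̄` per torus second-class domain above `c̄z` whose chart
`B ↦ ℰ_X̄(exp ρB)` is complex-analytic on `‖B‖ < α` and bounded there by `E₀exp(−κd_j(X̄))` ((2.27)(ii) + (iv) =
(I.1.18), `d_j = torusTreeLen`), ONE set of field pieces `λ_z, c, ℓ` at `σ = LʲL⁻ⁿ` ((I.4.16)–(I.4.17)), real main terms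
`|m(X̄)| ≤ ‖½D²f_X̄(0)(w, w)‖`: `|Σ_{X̄ torus second class above c̄z} m(X̄)| ≤ (C·E₀·K₀(4·2^d,2d)·(5/κ)⁵e⁻⁵)·(L^{j−n})^{5−β}`
for every `β ≥ 0` — «contributes to the irrelevant terms only, by the bounds (3.48)». [cite: Balaban1988Convergent,
p.281, (3.48) p.280, (2.27) p.259; Balaban1987RG1, (1.18) p.263, (4.16)–(4.17) p.285; Balaban1988RG2Cluster, (1.26) p.8] -/
theorem extensionDiff_secondAbove_torus_le (d P : ℕ) [NeZero P]
    {𝔤 : Type*} [LieRing 𝔤] [LieAlgebra ℝ 𝔤] (eV : V ≃ₗ[ℝ] 𝔤) (ρ : V →L[ℝ] 𝔄) {α : ℝ} (hα : 0 < α) {E₀ : ℝ}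
    (hE₀ : 0 ≤ E₀) {b : ℝ} (hb0 : 0 ≤ b) (hb : ∀ x y : V, ‖eV.symm ⁅eV x, eV y⁆‖ ≤ b * ‖x‖ * ‖y‖)
    {a : ℝ} (ha : 0 ≤ a) {C : ℝ} (hC : (2 : ℝ)⁻¹ * (4 / α) ^ 2 * (a + (2 : ℝ)⁻¹ * b * a ^ 2) ^ 2 ≤ C)
    {κ : ℝ} (hκ : kappa₀ (4 * 2 ^ d) (2 * d) ≤ κ / 2) (hκ0 : 0 < κ)
    {L : ℕ} (hL : 0 < L) {j n : ℕ} (hjn : j ≤ n) {β : ℝ} (hβ0 : 0 ≤ β)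
    (cz : TPt d P) (ℰ : (tsys d P).Dom → (Λ → T → 𝔄) → F)
    (hf : ∀ X ∈ ((tcubeSys d P).above cz).filter (TSecondAbove (L ^ (n - j)) cz),
      AnalyticOnNhd ℂ (fun A' : Λ → T → V => ℰ X (fun ν y => exp (ρ (A' ν y)))) (Metric.ball 0 α))
    (hS : ∀ X ∈ ((tcubeSys d P).above cz).filter (TSecondAbove (L ^ (n - j)) cz),
      ∀ A' ∈ Metric.ball (0 : Λ → T → V) α,
        ‖ℰ X (fun ν y => exp (ρ (A' ν y)))‖ ≤ E₀ * Real.exp (-κ * (tsys d P).dj X))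
    (lam : T → V) (cc ℓ : Λ → T → V) (hcn : ‖cc‖ ≤ a * (L : ℝ) ^ ((j : ℝ) - n))
    (hlam : ‖lam‖ ≤ a * (L : ℝ) ^ ((j : ℝ) - n)) (hℓ : ‖ℓ‖ ≤ a * ((L : ℝ) ^ ((j : ℝ) - n)) ^ 2)
    (m : (tsys d P).Dom → ℝ)
    (hm : ∀ X ∈ ((tcubeSys d P).above cz).filter (TSecondAbove (L ^ (n - j)) cz), |m X| ≤
      ‖(2 : ℝ)⁻¹ • fderiv ℝ (fderiv ℝ (fun A' : Λ → T → V => ℰ X (fun ν y => exp (ρ (A' ν y))))) 0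
        (ℓ + (2 : ℝ)⁻¹ • fun ν y => eV.symm ⁅eV (lam y), eV (cc ν y)⁆)
        (ℓ + (2 : ℝ)⁻¹ • fun ν y => eV.symm ⁅eV (lam y), eV (cc ν y)⁆)‖) :
    |∑ X ∈ ((tcubeSys d P).above cz).filter (TSecondAbove (L ^ (n - j)) cz), m X|
      ≤ (C * E₀ * K₀ (4 * 2 ^ d) (2 * d) * (((5 : ℝ) / κ) ^ 5 * Real.exp (-(5 : ℝ))))
        * ((L : ℝ) ^ ((j : ℝ) - n)) ^ ((5 : ℝ) - β) := by
  have hN : 0 < L ^ (n - j) := pow_pos hL _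
  have hL' : (0 : ℝ) < L := by exact_mod_cast hL
  have hL1 : (1 : ℝ) ≤ L := by exact_mod_cast hL
  have hclass : ∀ X ∈ (tcubeSys d P).above cz, TSecondAbove (L ^ (n - j)) cz X →
      2 * ((L : ℝ) ^ ((j : ℝ) - n))⁻¹ ≤ (tsys d P).dj X := by
    intro X hX hsec
    have h := thclass_tcubeSys d P hN cz X hX hsec
    rw [rpow_sub_eq_inv_pow hL' hjn, inv_inv]
    push_cast at h
    exact h
  exact Eq356ExtensionFeed.extensionDiff_secondClass_le (tcubeSys d P) (tdegreeLE d P) (tvolumeLeaf d P) hκ hκ0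
    eV ρ hα hE₀ hb0 hb ha hC hL1 hjn hβ0 cz (TSecondAbove (L ^ (n - j)) cz) hclass ℰ hf hS lam cc ℓ hcn hlam hℓ m hm

end Chart

/-! ## §3. The covering map above `□^{∼2}`: the torus first class IS the first class of the cover (unique lifting) -/

section Cover

variable {Nb Pb : ℕ}

/-- **Lift-independence** (the π_n-blocks tile the torus: `P = Nb·Pb` cubes per direction, `Pb` blocks per direction):
if `b̄ ∈ □^{∼r}(ā)` on the torus then above EVERY lift `x` of `ā` there is a lift `y` of `b̄` in the window `□^{∼r}(x)` of
the cover (translate by the deck transformation carrying one lift of `ā` to the other; `coarse` intertwines the deck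
groups, `TreeLengthTorusTransfer.coarse_add_period`; derived here, not printed — the covering-space bookkeeping of the
torus T of [I] p. 251 with its partition π_n). [cite: Balaban1987RG1, p.251 (torus), p.257 (localization domains);
Balaban1988Convergent, p.279 (the two cases (I.3.5))] -/
theorem exists_lift_inEnl_of_tInEnl (hNb : 0 < Nb) {r : ℕ} {a b : TPt d (Nb * Pb)} (h : TInEnl Nb r a b)
    {x : Pt d} (hx : proj (Nb * Pb) x = a) : ∃ y : Pt d, proj (Nb * Pb) y = b ∧ InEnl Nb r x y := by
  obtain ⟨x', y', hx', hy', hxy⟩ := h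
  obtain ⟨k, hk⟩ := exists_period_of_proj_eq (hx'.trans hx.symm)
  refine ⟨y' + period (Nb * Pb) k, by rw [proj_add_period, hy'], fun i => ?_⟩
  rw [hk, coarse_add_period hNb Pb, coarse_add_period hNb Pb]
  simp only [Pi.add_apply, add_sub_add_right_eq_sub]
  exact hxy i

/-- **«□^{∼r}» on the torus read in the cover above a FIXED lift**: for `P = Nb·Pb` and any lift `x` of `ā`,
`b̄ ∈ □^{∼r}(ā)` iff some lift of `b̄` lies in `□^{∼r}(x)` — the covering image of the window, as printed («the
∼-operation is in the L⁻ⁿ-scale» on the periodic lattice). [cite: Balaban1988Convergent, p.279 (the two cases (I.3.5));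
Balaban1987RG1, p.251 (torus)] -/
theorem tInEnl_iff_exists_lift (hNb : 0 < Nb) {r : ℕ} {a b : TPt d (Nb * Pb)} {x : Pt d}
    (hx : proj (Nb * Pb) x = a) :
    TInEnl Nb r a b ↔ ∃ y : Pt d, proj (Nb * Pb) y = b ∧ InEnl Nb r x y :=
  ⟨fun h => exists_lift_inEnl_of_tInEnl hNb h hx, fun ⟨y, hy, h⟩ => ⟨x, y, hx, hy, h⟩⟩

/-- Cubes with a common wall have indices differing by at most `1` in every coordinate. [folklore] -/
private theorem abs_sub_le_one_of_adj {u v : Pt d} (h : Adj u v) (i : Fin d) : |v i - u i| ≤ 1 := by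
  obtain ⟨l, h | h⟩ := h
  · rw [h]
    by_cases hi : i = l
    · subst hi
      simp
    · simp [Function.update_of_ne hi]
  · rw [h]
    by_cases hi : i = l
    · subst hi
      simp
    · simp [Function.update_of_ne hi]

/-- **Uniqueness of lifts inside the window** (`Pb ≥ 5` blocks per direction): two lifts of the same torus cube lying in
`□^{∼2}(x)` coincide — their block indices differ by a multiple of `Pb` and by at most `4` (covering-space bookkeeping of
the torus of [I] p. 251; derived here, not printed). [cite: Balaban1987RG1, p.251 (torus), p.257 (localization domains)] -/
theorem eq_of_inEnl_of_proj_eq (hNb : 0 < Nb) (hPb : 5 ≤ Pb) {x y y' : Pt d} (hy : InEnl Nb 2 x y)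
    (hy' : InEnl Nb 2 x y') (he : proj (Nb * Pb) y = proj (Nb * Pb) y') : y = y' := by
  obtain ⟨k, hk⟩ := exists_period_of_proj_eq he
  have hk0 : period (Nb * Pb) k = 0 := by
    funext i
    have h1 := hy i
    have h2 := hy' i
    rw [hk, coarse_add_period hNb Pb] at h2
    simp only [Pi.add_apply, period] at h2
    push_cast at h1 h2
    have hki : k i = 0 := by
      by_contra hki
      have hk1 : 1 ≤ |k i| := Int.one_le_abs hki
      have hPb' : (5 : ℤ) ≤ Pb := by exact_mod_cast hPb
      have hge : (5 : ℤ) ≤ |(Pb : ℤ) * k i| := by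
        rw [abs_mul, abs_of_nonneg (by positivity : (0 : ℤ) ≤ Pb)]
        nlinarith
      have e : (Pb : ℤ) * k i
          = (coarse Nb y i + (Pb : ℤ) * k i - coarse Nb x i) - (coarse Nb y i - coarse Nb x i) := by ring
      have hle : |(Pb : ℤ) * k i| ≤ 4 := by
        rw [e]
        exact (abs_sub _ _).trans (by linarith)
      linarith
    simp [period, hki]
  rw [hk, hk0, add_zero]

/-- **Common walls lift inside the window** (`Pb ≥ 6` blocks per direction): if `ā`, `b̄` have a common wall on the torus
and their lifts `ya`, `yb` lie in `□^{∼2}(x)`, then `ya`, `yb` have a common wall in the cover — the lifted neighbour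
`ya ± e_μ` of `b̄` (`TreeLengthTorus.exists_lift_adj`) has block indices within `3` of those of `x`, `yb` within `2`, and
they differ by a multiple of `Pb ≥ 6` (the *"common wall"* relation of [I] p. 257 through the covering map of the torus
of p. 251; derived here, not printed). [cite: Balaban1987RG1, p.257 (localization domains), p.251 (torus)] -/
theorem adj_of_lifts (hNb : 0 < Nb) (hPb : 6 ≤ Pb) {x ya yb : Pt d} {b : TPt d (Nb * Pb)}
    (hadj : TAdj (proj (Nb * Pb) ya) b) (hya : InEnl Nb 2 x ya) (hyb : InEnl Nb 2 x yb)
    (hb : proj (Nb * Pb) yb = b) : Adj ya yb := by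
  obtain ⟨yb', hyb', hadj'⟩ := exists_lift_adj hadj
  obtain ⟨k, hk⟩ := exists_period_of_proj_eq (hyb'.trans hb.symm)
  have hk0 : period (Nb * Pb) k = 0 := by
    funext i
    have h1 := hya i
    have h2 := hyb i
    have h3 : |coarse Nb yb' i - coarse Nb ya i| ≤ 1 := by
      rcases coarse_adj hNb hadj' with h | h
      · rw [h]
        simp
      · exact abs_sub_le_one_of_adj h i
    rw [hk, coarse_add_period hNb Pb] at h2
    simp only [Pi.add_apply, period] at h2
    push_cast at h1 h2
    have hki : k i = 0 := by
      by_contra hki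
      have hk1 : 1 ≤ |k i| := Int.one_le_abs hki
      have hPb' : (6 : ℤ) ≤ Pb := by exact_mod_cast hPb
      have hge : (6 : ℤ) ≤ |(Pb : ℤ) * k i| := by
        rw [abs_mul, abs_of_nonneg (by positivity : (0 : ℤ) ≤ Pb)]
        nlinarith
      have e : (Pb : ℤ) * k i
          = (coarse Nb yb' i + (Pb : ℤ) * k i - coarse Nb x i) - (coarse Nb yb' i - coarse Nb ya i)
            - (coarse Nb ya i - coarse Nb x i) := by ring
      have hle : |(Pb : ℤ) * k i| ≤ 5 := by
        rw [e]
        refine (abs_sub _ _).trans ?_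
        have := abs_sub (coarse Nb yb' i + (Pb : ℤ) * k i - coarse Nb x i) (coarse Nb yb' i - coarse Nb ya i)
        linarith
      linarith
    simp [period, hki]
  have hyb_eq : yb = yb' := by rw [hk, hk0, add_zero]
  rw [hyb_eq]
  exact hadj'

/-- **The lift of a torus family inside the window**: the cubes of `□^{∼2}(x)` (a finite window of the cover,
`…Eq357ExtensionZd.finite_inEnl`) projecting into `X̄` — for `X̄ ⊂ □^{∼2}` the unique lift of `X̄` through the covering
map. (Junk value `∅` for `Nb = 0`.) [cite: Balaban1988Convergent, p.281; Balaban1987RG1, p.251 (torus)] -/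
def tlift (Nb : ℕ) (x : Pt d) (Xb : Finset (TPt d P)) : Finset (Pt d) :=
  if h : 0 < Nb then (finite_inEnl h 2 x).toFinset.filter (fun y => proj P y ∈ Xb) else ∅

/-- Membership in `tlift`: a cube of the window `□^{∼2}(x)` of the cover projecting into `X̄`.
[cite: Balaban1988Convergent, p.281; Balaban1987RG1, p.251 (torus)] -/
theorem mem_tlift (hNb : 0 < Nb) {x : Pt d} {Xb : Finset (TPt d P)} {y : Pt d} :
    y ∈ tlift Nb x Xb ↔ InEnl Nb 2 x y ∧ proj P y ∈ Xb := by
  rw [tlift, dif_pos hNb, Finset.mem_filter, Set.Finite.mem_toFinset]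
  rfl

/-- The lift `x` of `c̄z ∈ X̄` belongs to the lift of `X̄` («X containing the point z» on both carriers).
[cite: Balaban1988Convergent, p.281; Balaban1987RG1, p.251 (torus)] -/
theorem self_mem_tlift (hNb : 0 < Nb) {x : Pt d} {cz : TPt d P} (hx : proj P x = cz) {Xb : Finset (TPt d P)}
    (hcz : cz ∈ Xb) : x ∈ tlift Nb x Xb :=
  (mem_tlift hNb).2 ⟨inEnl_refl _ _ _, by rw [hx]; exact hcz⟩

variable [NeZero Nb] [NeZero Pb]

omit [NeZero Pb] in
/-- **The lift projects ONTO a first-class family**: for `X̄ ⊂ □^{∼2}(c̄z)` every cube of `X̄` has a lift in the window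
above `x` (lift-independence), so `proj(tlift X̄) = X̄` (derived here, not printed). [cite: Balaban1988Convergent, p.281;
Balaban1987RG1, p.251 (torus)] -/
theorem image_proj_tlift {x : Pt d} {cz : TPt d (Nb * Pb)} (hx : proj (Nb * Pb) x = cz)
    {Xb : Finset (TPt d (Nb * Pb))} (hfirst : ∀ b ∈ Xb, TInEnl Nb 2 cz b) :
    (tlift Nb x Xb).image (proj (Nb * Pb)) = Xb := by
  have hNb : 0 < Nb := Nat.pos_of_ne_zero (NeZero.ne Nb)
  ext b
  constructor
  · intro hb
    obtain ⟨y, hy, rfl⟩ := Finset.mem_image.1 hb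
    exact ((mem_tlift hNb).1 hy).2
  · intro hb
    obtain ⟨y, hyb, hy⟩ := exists_lift_inEnl_of_tInEnl hNb (hfirst b hb) hx
    refine Finset.mem_image.2 ⟨y, (mem_tlift hNb).2 ⟨hy, ?_⟩, hyb⟩
    rw [hyb]
    exact hb

omit [NeZero Pb] in
/-- **The lift of a first-class torus domain is face-connected** (`Pb ≥ 6`): a chain of torus cubes with common walls
inside `X̄ ⊂ □^{∼2}(c̄z)` lifts step by step inside the window (`adj_of_lifts`), and lifts inside the window are unique
(`eq_of_inEnl_of_proj_eq`). [cite: Balaban1987RG1, p.257 (localization domains), p.251 (torus)] -/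
theorem faceConnected_tlift (hPb : 6 ≤ Pb) {x : Pt d} {cz : TPt d (Nb * Pb)} (hx : proj (Nb * Pb) x = cz)
    {Xb : Finset (TPt d (Nb * Pb))} (hc : TFaceConnected Xb) (hfirst : ∀ b ∈ Xb, TInEnl Nb 2 cz b) :
    FaceConnected (tlift Nb x Xb) := by
  have hNb : 0 < Nb := Nat.pos_of_ne_zero (NeZero.ne Nb)
  intro y hy y' hy'
  obtain ⟨-, hyX⟩ := (mem_tlift hNb).1 hy
  obtain ⟨hy'w, hy'X⟩ := (mem_tlift hNb).1 hy'
  have key : ∀ b, TLinked Xb (proj (Nb * Pb) y) b →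
      ∃ yb ∈ tlift Nb x Xb, proj (Nb * Pb) yb = b ∧ Linked (tlift Nb x Xb) y yb := by
    intro b hb
    unfold TLinked at hb
    induction hb with
    | refl => exact ⟨y, hy, rfl, Relation.ReflTransGen.refl⟩
    | @tail b c _ hbc ih =>
      obtain ⟨yb, hybm, hybp, hlink⟩ := ih
      obtain ⟨-, hcX, hadj⟩ := hbc
      obtain ⟨yc, hycp, hycw⟩ := exists_lift_inEnl_of_tInEnl hNb (hfirst c hcX) hx
      have hybw := ((mem_tlift hNb).1 hybm).1
      rw [← hybp] at hadj
      have hadj' : Adj yb yc := adj_of_lifts hNb hPb hadj hybw hycw hycp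
      have hycm : yc ∈ tlift Nb x Xb := (mem_tlift hNb).2 ⟨hycw, by rw [hycp]; exact hcX⟩
      exact ⟨yc, hycm, hycp, hlink.tail ⟨hybm, hycm, hadj'⟩⟩
  obtain ⟨yb, hybm, hybp, hlink⟩ := key _ (hc _ hyX _ hy'X)
  have hle : 5 ≤ Pb := le_trans (by norm_num) hPb
  have heq : yb = y' := eq_of_inEnl_of_proj_eq hNb hle ((mem_tlift hNb).1 hybm).1 hy'w hybp
  rw [← heq]
  exact hlink

/-- **THE FIRST CLASS ABOVE `□_z` OF THE TORUS IS THE FIRST CLASS ABOVE A LIFT `x` ON `L⁻ʲZ^d`** (torus of `Nb·Pb` cubes per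
direction, `Pb ≥ 6` blocks per direction, so that `□^{∼2}` — five blocks wide — does not wrap): the torus localization
domains above `c̄z` outside the torus second class («X ⊂ □^{∼2}») correspond one-to-one to the localization domains
`Y ∈ 𝐃_j` of the infinite lattice with `FirstAbove Nb x Y`, by LIFTING (`X̄ ↦ tlift X̄`, inverse `Y ↦ proj(Y)`):
the identification `e` that `…Eq357ExtensionZd.sum_torusFirst_eq_of_equiv` / `abs_sum_torusFirst_sub_tsum_le` took as a
HYPOTHESIS, constructed for Bałaban's periodic carrier.  Stated as the existence of an `Equiv` whose value on `X̄` is the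
lift of `X̄` and projects back onto `X̄`. [cite: Balaban1988Convergent, p.279 (the two cases (I.3.5)), p.281;
Balaban1987RG1, p.251 (torus), p.257 (localization domains)] -/
theorem exists_firstClassEquiv_torus (hPb : 6 ≤ Pb) {x : Pt d} {cz : TPt d (Nb * Pb)}
    (hx : proj (Nb * Pb) x = cz) :
    ∃ e : {X // X ∈ ((tcubeSys d (Nb * Pb)).above cz).filter (fun X => ¬ TSecondAbove Nb cz X)}
        ≃ {Y : LocDom d // FirstAbove Nb x Y},
      ∀ X, (e X).1.1 = tlift Nb x X.1.1 ∧ ((e X).1.1).image (proj (Nb * Pb)) = X.1.1 := by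
  classical
  have hNb : 0 < Nb := Nat.pos_of_ne_zero (NeZero.ne Nb)
  have hle : 5 ≤ Pb := le_trans (by norm_num) hPb
  have key : ∀ X : (tsys d (Nb * Pb)).Dom,
      X ∈ ((tcubeSys d (Nb * Pb)).above cz).filter (fun X => ¬ TSecondAbove Nb cz X)
        ↔ cz ∈ X.1 ∧ ∀ b ∈ X.1, TInEnl Nb 2 cz b := by
    intro X
    rw [Finset.mem_filter, CubeSystem.mem_above, not_tSecondAbove_iff, tcubeSys_cubes]
    exact Iff.rfl
  refine ⟨{ toFun := fun X =>
              ⟨⟨tlift Nb x X.1.1,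
                ⟨x, self_mem_tlift hNb hx ((key X.1).1 X.2).1⟩,
                faceConnected_tlift hPb hx X.1.2.2 ((key X.1).1 X.2).2⟩,
               self_mem_tlift hNb hx ((key X.1).1 X.2).1, fun y hy => ((mem_tlift hNb).1 hy).1⟩
            invFun := fun Y =>
              ⟨⟨Y.1.1.image (proj (Nb * Pb)), Y.1.2.1.image _, tFaceConnected_image Y.1.2.2⟩,
               (key _).2 ⟨by rw [← hx]; exact Finset.mem_image_of_mem _ Y.2.1, fun b hb => by
                  obtain ⟨y, hy, rfl⟩ := Finset.mem_image.1 hb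
                  rw [← hx]
                  exact tInEnl_of_inEnl (Y.2.2 y hy)⟩⟩
            left_inv := fun X => ?_
            right_inv := fun Y => ?_ }, fun X => ⟨rfl, image_proj_tlift hx ((key X.1).1 X.2).2⟩⟩
  · apply Subtype.ext
    apply Subtype.ext
    exact image_proj_tlift hx ((key X.1).1 X.2).2
  · apply Subtype.ext
    apply Subtype.ext
    show tlift Nb x (Y.1.1.image (proj (Nb * Pb))) = Y.1.1
    ext y
    rw [mem_tlift hNb]
    constructor
    · rintro ⟨hyw, hyp⟩
      obtain ⟨y₀, hy₀, he⟩ := Finset.mem_image.1 hyp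
      have heq : y₀ = y := eq_of_inEnl_of_proj_eq hNb hle (Y.2.2 y₀ hy₀) hyw he
      rw [← heq]
      exact hy₀
    · intro hy
      exact ⟨Y.2.2 y hy, Finset.mem_image_of_mem _ hy⟩

/-- **The §5 identity of `…Eq357ExtensionZd` FOR THE TORUS, identification constructed**: for a torus of `Nb·Pb` cubes per
direction (`Pb ≥ 6`), a lift `x` of the cube `c̄z` of `z`, torus terms `mT` and whole-lattice terms `mZ` that AGREE ON
IDENTIFIED DOMAINS — `mT X̄ = mZ Y` whenever `Y` is a first-class domain above `x` projecting onto `X̄` ((2.27)(i) *"it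
depends on U_k restricted to X"* with the inductive construction of the same local functionals on every lattice; the only
remaining hypothesis, and it concerns the TERMS, not the domains) — the torus first-class sum «over all such domains»
equals the whole-lattice series over «X containing the point z» minus the second-class series of `L⁻ʲZ^d`.
[cite: Balaban1988Convergent, (3.56)–(3.57) p.281, (2.27) p.259] -/
theorem sum_torusFirst_eq (hPb : 6 ≤ Pb) {x : Pt d} {cz : TPt d (Nb * Pb)} (hx : proj (Nb * Pb) x = cz)
    (mT : (tsys d (Nb * Pb)).Dom → ℝ) (mZ : LocDom d → ℝ)
    (hterm : ∀ (X : (tsys d (Nb * Pb)).Dom) (Y : LocDom d), FirstAbove Nb x Y →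
      Y.1.image (proj (Nb * Pb)) = X.1 → mT X = mZ Y)
    (hs : Summable fun Y : LocDom d => if SecondAbove Nb x Y then mZ Y else 0) :
    ∑ X ∈ ((tcubeSys d (Nb * Pb)).above cz).filter (fun X => ¬ TSecondAbove Nb cz X), mT X
      = ∑' Y : LocDom d, (if x ∈ Y.1 then mZ Y else 0)
        - ∑' Y : LocDom d, (if SecondAbove Nb x Y then mZ Y else 0) := by
  classical
  have hNb : 0 < Nb := Nat.pos_of_ne_zero (NeZero.ne Nb)
  obtain ⟨e, he⟩ := exists_firstClassEquiv_torus (d := d) hPb hx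
  exact sum_torusFirst_eq_of_equiv (tcubeSys d (Nb * Pb)) cz (TSecondAbove Nb cz) mT hNb x mZ e
    (fun X => hterm X.1 (e X).1 (e X).2 (he X).2) hs

/-- **«The difference between the two sums contributes to the irrelevant terms only, by the bounds (3.48)»** FOR THE
TORUS, signed form: under the term identification of `sum_torusFirst_eq`, any bound `R` on the second-class series of
`L⁻ʲZ^d` above `x` (`…Eq357ExtensionZd` §2, or its §4 at chart level) bounds
`|Σ_{torus first class above c̄z} mT − Σ'_{Y ∋ x} mZ|`. [cite: Balaban1988Convergent, p.281, (3.48) p.280] -/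
theorem abs_sum_torusFirst_sub_tsum_le (hPb : 6 ≤ Pb) {x : Pt d} {cz : TPt d (Nb * Pb)}
    (hx : proj (Nb * Pb) x = cz) (mT : (tsys d (Nb * Pb)).Dom → ℝ) (mZ : LocDom d → ℝ)
    (hterm : ∀ (X : (tsys d (Nb * Pb)).Dom) (Y : LocDom d), FirstAbove Nb x Y →
      Y.1.image (proj (Nb * Pb)) = X.1 → mT X = mZ Y) {R : ℝ}
    (hs : Summable fun Y : LocDom d => if SecondAbove Nb x Y then mZ Y else 0)
    (hR : |∑' Y : LocDom d, (if SecondAbove Nb x Y then mZ Y else 0)| ≤ R) :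
    |∑ X ∈ ((tcubeSys d (Nb * Pb)).above cz).filter (fun X => ¬ TSecondAbove Nb cz X), mT X
        - ∑' Y : LocDom d, (if x ∈ Y.1 then mZ Y else 0)| ≤ R := by
  classical
  have hNb : 0 < Nb := Nat.pos_of_ne_zero (NeZero.ne Nb)
  obtain ⟨e, he⟩ := exists_firstClassEquiv_torus (d := d) hPb hx
  exact Eq357ExtensionZd.abs_sum_torusFirst_sub_tsum_le (tcubeSys d (Nb * Pb)) cz (TSecondAbove Nb cz) mT hNb x
    mZ e (fun X => hterm X.1 (e X).1 (e X).2 (he X).2) hs hR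

variable {𝔄 : Type*} [NormedRing 𝔄] [NormedAlgebra ℝ 𝔄] {Λ T : Type*} [Fintype Λ] [Fintype T]
  {V : Type*} [NormedAddCommGroup V] [NormedSpace ℂ V] {F : Type*} [NormedAddCommGroup F]
  [NormedSpace ℂ F] [CompleteSpace F]

open NormedSpace (exp)

-- (the nested operator space over the iterated `Pi` type: one more level of pending instance synthesis)
set_option maxSynthPendingDepth 3 in
/-- **p. 281 FOR BAŁABAN'S TORUS, identification constructed**: under the chart hypotheses of
`…Eq357ExtensionZd.extensionDiff_secondAbove_le` on the second class of `L⁻ʲZ^d` above a lift `x` of the cube `c̄z` of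
`z` (scale data `L ≥ 1`, `j ≤ n`, `Nb = Lⁿ⁻ʲ`; torus of `Lⁿ⁻ʲ·Pb` cubes of π_j per direction, `Pb ≥ 6` cubes of π_n per
direction) and the term identification `hterm` of `sum_torusFirst_eq` ((2.27)(i)): the first-class sum of the TORUS
system above `c̄z` (the sum «over all such domains», i.e. over the torus domains `X̄ ∋ □_z`, `X̄ ⊂ □̃^{∼2}`) differs from the
whole-lattice series `Σ'_{Y ∋ x} mZ(Y)` («all domains X ∈ 𝐃_j for the space L⁻ʲZ^d, X containing the point z») by at most
`(C·E₀·K₀(4·2^d, 2d)·(5/κ)⁵e⁻⁵)·(L^{j−n})^{5−β}` — «The difference between the two sums contributes to the irrelevant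
terms only, by the bounds (3.48)». [cite: Balaban1988Convergent, (3.56)–(3.57) p.281, (3.48) p.280, (2.27) p.259;
Balaban1987RG1, (1.18) p.263, (4.16)–(4.17) p.285, p.251 (torus); Balaban1988RG2Cluster, (1.26) p.8] -/
theorem extension357_torus_of_charts (hPb : 6 ≤ Pb)
    {𝔤 : Type*} [LieRing 𝔤] [LieAlgebra ℝ 𝔤] (eV : V ≃ₗ[ℝ] 𝔤) (ρ : V →L[ℝ] 𝔄) {α : ℝ} (hα : 0 < α) {E₀ : ℝ}
    (hE₀ : 0 ≤ E₀) {b : ℝ} (hb0 : 0 ≤ b) (hb : ∀ x y : V, ‖eV.symm ⁅eV x, eV y⁆‖ ≤ b * ‖x‖ * ‖y‖)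
    {a : ℝ} (ha : 0 ≤ a) {C : ℝ} (hC : (2 : ℝ)⁻¹ * (4 / α) ^ 2 * (a + (2 : ℝ)⁻¹ * b * a ^ 2) ^ 2 ≤ C)
    {κ : ℝ} (hκ : kappa₀ (4 * 2 ^ d) (2 * d) ≤ κ / 2) (hκ0 : 0 < κ)
    {L : ℕ} (hL : 0 < L) {j n : ℕ} (hjn : j ≤ n) {β : ℝ} (hβ0 : 0 ≤ β) (hNb : Nb = L ^ (n - j))
    {x : Pt d} {cz : TPt d (Nb * Pb)} (hx : proj (Nb * Pb) x = cz)
    (ℰ : LocDom d → (Λ → T → 𝔄) → F)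
    (hf : ∀ Y, SecondAbove Nb x Y →
      AnalyticOnNhd ℂ (fun A' : Λ → T → V => ℰ Y (fun ν y => exp (ρ (A' ν y)))) (Metric.ball 0 α))
    (hS : ∀ Y, SecondAbove Nb x Y → ∀ A' ∈ Metric.ball (0 : Λ → T → V) α,
      ‖ℰ Y (fun ν y => exp (ρ (A' ν y)))‖ ≤ E₀ * Real.exp (-κ * treeLen Y.1))
    (lam : T → V) (cc ℓ : Λ → T → V) (hcn : ‖cc‖ ≤ a * (L : ℝ) ^ ((j : ℝ) - n))
    (hlam : ‖lam‖ ≤ a * (L : ℝ) ^ ((j : ℝ) - n)) (hℓ : ‖ℓ‖ ≤ a * ((L : ℝ) ^ ((j : ℝ) - n)) ^ 2)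
    (mZ : LocDom d → ℝ)
    (hm : ∀ Y, SecondAbove Nb x Y → |mZ Y| ≤
      ‖(2 : ℝ)⁻¹ • fderiv ℝ (fderiv ℝ (fun A' : Λ → T → V => ℰ Y (fun ν y => exp (ρ (A' ν y))))) 0
        (ℓ + (2 : ℝ)⁻¹ • fun ν y => eV.symm ⁅eV (lam y), eV (cc ν y)⁆)
        (ℓ + (2 : ℝ)⁻¹ • fun ν y => eV.symm ⁅eV (lam y), eV (cc ν y)⁆)‖)
    (mT : (tsys d (Nb * Pb)).Dom → ℝ)
    (hterm : ∀ (X : (tsys d (Nb * Pb)).Dom) (Y : LocDom d), FirstAbove Nb x Y →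
      Y.1.image (proj (Nb * Pb)) = X.1 → mT X = mZ Y) :
    |∑ X ∈ ((tcubeSys d (Nb * Pb)).above cz).filter (fun X => ¬ TSecondAbove Nb cz X), mT X
        - ∑' Y : LocDom d, (if x ∈ Y.1 then mZ Y else 0)|
      ≤ (C * E₀ * K₀ (4 * 2 ^ d) (2 * d) * (((5 : ℝ) / κ) ^ 5 * Real.exp (-(5 : ℝ))))
        * ((L : ℝ) ^ ((j : ℝ) - n)) ^ ((5 : ℝ) - β) := by
  classical
  subst hNb
  obtain ⟨hs, hR⟩ := extensionDiff_secondAbove_le eV ρ hα hE₀ hb0 hb ha hC hκ hκ0 hL hjn hβ0 x ℰ hf hS lam cc ℓ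
    hcn hlam hℓ mZ hm
  exact abs_sum_torusFirst_sub_tsum_le hPb hx mT mZ hterm hs hR

/-! ## §4. Both classes at once: the whole torus sum above `□_z` versus the (3.57) whole-lattice coefficient -/

omit [NeZero Nb] [NeZero Pb] in
/-- The sum over ALL torus domains above `c̄z` splits into its first-class part («all such domains», `X̄ ⊂ □^{∼2}`) and
its second-class part (disposed of at (3.48): *"In the proof of Theorem 2 we simply estimate all these terms using the
above bound"*). [cite: Balaban1988Convergent, p.280, p.281] -/
theorem sum_above_eq_first_add_second {P : ℕ} [NeZero P] (Nb : ℕ) (cz : TPt d P) (mT : (tsys d P).Dom → ℝ) :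
    ∑ X ∈ (tcubeSys d P).above cz, mT X
      = ∑ X ∈ ((tcubeSys d P).above cz).filter (fun X => ¬ TSecondAbove Nb cz X), mT X
        + ∑ X ∈ ((tcubeSys d P).above cz).filter (TSecondAbove Nb cz), mT X := by
  rw [← Finset.sum_filter_add_sum_filter_not ((tcubeSys d P).above cz) (TSecondAbove Nb cz) mT, add_comm]

/-- **pp. 280–281 together, FOR THE TORUS**: the sum of the torus terms over ALL localization domains `X̄ ∋ □_z` of the
torus differs from the whole-lattice series `Σ'_{Y ∋ x} mZ(Y)` (the (3.57) coefficient) by at most `R_Z + R_T`, where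
`R_T` bounds the torus second-class sum ((3.48) on the torus, §2) and `R_Z` the second-class series of `L⁻ʲZ^d` above the
lift `x` (`…Eq357ExtensionZd` §2/§4) — under the term identification (2.27)(i) on the first class only.
[cite: Balaban1988Convergent, (3.48) p.280, (3.56)–(3.57) p.281, (2.27) p.259] -/
theorem abs_sum_torusAbove_sub_tsum_le (hPb : 6 ≤ Pb) {x : Pt d} {cz : TPt d (Nb * Pb)}
    (hx : proj (Nb * Pb) x = cz) (mT : (tsys d (Nb * Pb)).Dom → ℝ) (mZ : LocDom d → ℝ)
    (hterm : ∀ (X : (tsys d (Nb * Pb)).Dom) (Y : LocDom d), FirstAbove Nb x Y →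
      Y.1.image (proj (Nb * Pb)) = X.1 → mT X = mZ Y) {RZ RT : ℝ}
    (hs : Summable fun Y : LocDom d => if SecondAbove Nb x Y then mZ Y else 0)
    (hRZ : |∑' Y : LocDom d, (if SecondAbove Nb x Y then mZ Y else 0)| ≤ RZ)
    (hRT : |∑ X ∈ ((tcubeSys d (Nb * Pb)).above cz).filter (TSecondAbove Nb cz), mT X| ≤ RT) :
    |∑ X ∈ (tcubeSys d (Nb * Pb)).above cz, mT X - ∑' Y : LocDom d, (if x ∈ Y.1 then mZ Y else 0)|
      ≤ RZ + RT := by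
  have h1 := abs_sum_torusFirst_sub_tsum_le hPb hx mT mZ hterm hs hRZ
  rw [sum_above_eq_first_add_second Nb cz mT]
  have e : ∑ X ∈ ((tcubeSys d (Nb * Pb)).above cz).filter (fun X => ¬ TSecondAbove Nb cz X), mT X
        + ∑ X ∈ ((tcubeSys d (Nb * Pb)).above cz).filter (TSecondAbove Nb cz), mT X
        - ∑' Y : LocDom d, (if x ∈ Y.1 then mZ Y else 0)
      = (∑ X ∈ ((tcubeSys d (Nb * Pb)).above cz).filter (fun X => ¬ TSecondAbove Nb cz X), mT X
          - ∑' Y : LocDom d, (if x ∈ Y.1 then mZ Y else 0))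
        + ∑ X ∈ ((tcubeSys d (Nb * Pb)).above cz).filter (TSecondAbove Nb cz), mT X := by ring
  rw [e]
  exact (abs_add_le _ _).trans (add_le_add h1 hRT)

-- (the nested operator space over the iterated `Pi` type: one more level of pending instance synthesis)
set_option maxSynthPendingDepth 3 in
/-- **pp. 280–281 FOR BAŁABAN'S TORUS AT CHART LEVEL, both classes, identification constructed**: torus of `Lⁿ⁻ʲ·Pb` cubes
of π_j per direction (`Pb ≥ 6` cubes of π_n per direction), `x` a lift of the cube `c̄z` of `z`; chart hypotheses
((2.27)(ii) + (iv) = (I.1.18), field pieces (I.4.16)–(I.4.17) at `σ = LʲL⁻ⁿ`, main terms dominated by `‖½D²f(0)(w, w)‖`)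
on the TORUS second class above `c̄z` (sizes `E₀e^{−κd_j(X̄)}`, `d_j = torusTreeLen`) and on the second class of `L⁻ʲZ^d`
above `x` (sizes `E₀e^{−κd_j(Y)}`, `d_j = treeLen`), and the first-class term identification (2.27)(i): the sum of the
torus main terms over ALL `X̄ ∈ 𝐃_j`, `X̄ ∋ □_z` differs from the whole-lattice series `Σ'_{Y ∋ x} mZ(Y)` of (3.57) by at
most `2·(C·E₀·K₀(4·2^d, 2d)·(5/κ)⁵e⁻⁵)·(L^{j−n})^{5−β}` — (3.48) *"an admissible error"* plus «the difference between the two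
sums contributes to the irrelevant terms only». [cite: Balaban1988Convergent, (3.48) p.280, (3.56)–(3.57) p.281, (2.27)
p.259; Balaban1987RG1, (1.18) p.263, (4.16)–(4.17) p.285, p.251 (torus); Balaban1988RG2Cluster, (1.26) p.8] -/
theorem extension357_torusAbove_of_charts (hPb : 6 ≤ Pb)
    {𝔤 : Type*} [LieRing 𝔤] [LieAlgebra ℝ 𝔤] (eV : V ≃ₗ[ℝ] 𝔤) (ρ : V →L[ℝ] 𝔄) {α : ℝ} (hα : 0 < α) {E₀ : ℝ}
    (hE₀ : 0 ≤ E₀) {b : ℝ} (hb0 : 0 ≤ b) (hb : ∀ x y : V, ‖eV.symm ⁅eV x, eV y⁆‖ ≤ b * ‖x‖ * ‖y‖)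
    {a : ℝ} (ha : 0 ≤ a) {C : ℝ} (hC : (2 : ℝ)⁻¹ * (4 / α) ^ 2 * (a + (2 : ℝ)⁻¹ * b * a ^ 2) ^ 2 ≤ C)
    {κ : ℝ} (hκ : kappa₀ (4 * 2 ^ d) (2 * d) ≤ κ / 2) (hκ0 : 0 < κ)
    {L : ℕ} (hL : 0 < L) {j n : ℕ} (hjn : j ≤ n) {β : ℝ} (hβ0 : 0 ≤ β) (hNb : Nb = L ^ (n - j))
    {x : Pt d} {cz : TPt d (Nb * Pb)} (hx : proj (Nb * Pb) x = cz)
    (lam : T → V) (cc ℓ : Λ → T → V) (hcn : ‖cc‖ ≤ a * (L : ℝ) ^ ((j : ℝ) - n))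
    (hlam : ‖lam‖ ≤ a * (L : ℝ) ^ ((j : ℝ) - n)) (hℓ : ‖ℓ‖ ≤ a * ((L : ℝ) ^ ((j : ℝ) - n)) ^ 2)
    (ℰT : (tsys d (Nb * Pb)).Dom → (Λ → T → 𝔄) → F)
    (hfT : ∀ X ∈ ((tcubeSys d (Nb * Pb)).above cz).filter (TSecondAbove Nb cz),
      AnalyticOnNhd ℂ (fun A' : Λ → T → V => ℰT X (fun ν y => exp (ρ (A' ν y)))) (Metric.ball 0 α))
    (hST : ∀ X ∈ ((tcubeSys d (Nb * Pb)).above cz).filter (TSecondAbove Nb cz),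
      ∀ A' ∈ Metric.ball (0 : Λ → T → V) α,
        ‖ℰT X (fun ν y => exp (ρ (A' ν y)))‖ ≤ E₀ * Real.exp (-κ * (tsys d (Nb * Pb)).dj X))
    (mT : (tsys d (Nb * Pb)).Dom → ℝ)
    (hmT : ∀ X ∈ ((tcubeSys d (Nb * Pb)).above cz).filter (TSecondAbove Nb cz), |mT X| ≤
      ‖(2 : ℝ)⁻¹ • fderiv ℝ (fderiv ℝ (fun A' : Λ → T → V => ℰT X (fun ν y => exp (ρ (A' ν y))))) 0
        (ℓ + (2 : ℝ)⁻¹ • fun ν y => eV.symm ⁅eV (lam y), eV (cc ν y)⁆)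
        (ℓ + (2 : ℝ)⁻¹ • fun ν y => eV.symm ⁅eV (lam y), eV (cc ν y)⁆)‖)
    (ℰZ : LocDom d → (Λ → T → 𝔄) → F)
    (hfZ : ∀ Y, SecondAbove Nb x Y →
      AnalyticOnNhd ℂ (fun A' : Λ → T → V => ℰZ Y (fun ν y => exp (ρ (A' ν y)))) (Metric.ball 0 α))
    (hSZ : ∀ Y, SecondAbove Nb x Y → ∀ A' ∈ Metric.ball (0 : Λ → T → V) α,
      ‖ℰZ Y (fun ν y => exp (ρ (A' ν y)))‖ ≤ E₀ * Real.exp (-κ * treeLen Y.1))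
    (mZ : LocDom d → ℝ)
    (hmZ : ∀ Y, SecondAbove Nb x Y → |mZ Y| ≤
      ‖(2 : ℝ)⁻¹ • fderiv ℝ (fderiv ℝ (fun A' : Λ → T → V => ℰZ Y (fun ν y => exp (ρ (A' ν y))))) 0
        (ℓ + (2 : ℝ)⁻¹ • fun ν y => eV.symm ⁅eV (lam y), eV (cc ν y)⁆)
        (ℓ + (2 : ℝ)⁻¹ • fun ν y => eV.symm ⁅eV (lam y), eV (cc ν y)⁆)‖)
    (hterm : ∀ (X : (tsys d (Nb * Pb)).Dom) (Y : LocDom d), FirstAbove Nb x Y →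
      Y.1.image (proj (Nb * Pb)) = X.1 → mT X = mZ Y) :
    |∑ X ∈ (tcubeSys d (Nb * Pb)).above cz, mT X - ∑' Y : LocDom d, (if x ∈ Y.1 then mZ Y else 0)|
      ≤ 2 * ((C * E₀ * K₀ (4 * 2 ^ d) (2 * d) * (((5 : ℝ) / κ) ^ 5 * Real.exp (-(5 : ℝ))))
        * ((L : ℝ) ^ ((j : ℝ) - n)) ^ ((5 : ℝ) - β)) := by
  classical
  subst hNb
  obtain ⟨hs, hRZ⟩ := extensionDiff_secondAbove_le eV ρ hα hE₀ hb0 hb ha hC hκ hκ0 hL hjn hβ0 x ℰZ hfZ hSZ lam cc ℓ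
    hcn hlam hℓ mZ hmZ
  have hRT := extensionDiff_secondAbove_torus_le d (L ^ (n - j) * Pb) eV ρ hα hE₀ hb0 hb ha hC hκ hκ0 hL hjn hβ0 cz
    ℰT hfT hST lam cc ℓ hcn hlam hℓ mT hmT
  rw [two_mul]
  exact abs_sum_torusAbove_sub_tsum_le hPb hx mT mZ hterm hs hRZ hRT

end Cover

end

end Literature.MathematicalPhysics.QuantumFieldTheory.Balaban1983to89.B14.Eq348TorusClasses
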